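import Mathlib.Analysis.SpecialFunctions.Complex.Log
import Mathlib.Analysis.SpecialFunctions.Complex.Arg
import Mathlib.Analysis.SpecialFunctions.Trigonometric.Basic
import Mathlib.Analysis.Calculus.MeanValue
import Mathlib.Analysis.Calculus.Deriv.Comp
import Mathlib.Analysis.Calculus.FDeriv.Mul
import Literature.MathematicalPhysics.QuantumLattice.SchwingerWightman
import HarnessLib

/-!
# Complex boosts of boost-covariant holomorphic functions on the one-point forward tube

Topic `Literature/MathematicalPhysics/QuantumLattice` (trunk T-AQFT). An elementary substitute, in one
vector variable and for the one-parameter group of boosts in the `(0, 3)`-plane, of the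
Bargmann–Hall–Wightman continuation (Streater–Wightman (1964), §2-4, Thm. 2-11) as it is used in the
proof of the spin–statistics theorem (§4-4, Thms. 4-9, 4-10, eqs. (4-43)–(4-46) and (4-51): "`Ŵ` is
invariant under the complex proper Lorentz transformation `Λ = −1`", "a consequence of the
transformation law of `Ŵ` under `SL(2, ℂ) ⊗ SL(2, ℂ)`").

Setting: `F` is holomorphic on the (one-point, upper) forward tube
`T⁺ = {ζ ∈ ℂ⁴ | Im ζ ∈ V₊}` (`upperTube`, `= forwardTube 3 1` in one variable) with values in a
complex Banach space, and *covariant under the real boosts* `B(χ)` of rapidity `χ` in the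
`(0, 3)`-plane: `F(B(χ)ζ) = M(χ) F(ζ)` with `M : ℂ → (E →L[ℂ] E)` an entire one-parameter group
(`M(a + b) = M(a) M(b)`, `M(0) = 1`). In light-cone coordinates `u = ζ⁰ + ζ³`, `v = ζ⁰ − ζ³` the complex
boost `B(w)` acts by `u ↦ e^{w} u`, `v ↦ e^{−w} v` (`boost`), and `T⁺` is
`{Im u > 0, Im v > 0, Im u · Im v > (Im ζ¹)² + (Im ζ²)²}` (`mem_upperTube_iff`).

* `boost_covariance_complex` (**complex boost covariance inside the tube**): for `ζ ∈ T⁺` and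
  complex rapidity `w` with `B(w)ζ ∈ T⁺` and `|arg u − arg v + 2 Im w| < π`,
  `F(B(w)ζ) = M(w) F(ζ)`. Proof: on this set of `w` (open, convex: `convex_boostDomain`, a strip
  `ℝ × (b₋, b₊)` described by `cos (arg u − arg v + 2 Im w) > c`), `w ↦ M(−w) F(B(w)ζ)` is
  holomorphic and invariant under real translations, so its complex derivative vanishes
  (`hasDerivAt_zero_of_real_periodic`) and it is constant (mean value inequality).
* `wedgeExtension` and `differentiableOn_wedgeExtension`, `wedgeExtension_eq` (**continuation to
  the right wedge**): `F♯(ζ) = M(−iπ/2) F(B(iπ/2)ζ)` is holomorphic on the open set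
  `𝒩 = {B(iπ/2)ζ ∈ T⁺, Re u > 0, Re v < 0}`, which contains all real points `ξ` with `ξ³ > |ξ⁰|`
  (`complexifyPoint_mem_wedgeDomain`), and `F♯ = F` on `𝒩 ∩ T⁺`. Thus `F` extends holomorphically
  from `T⁺` across the real spacelike wedge `{ξ³ > |ξ⁰|}` (the Jost points adapted to the boost;
  S–W Thm. 2-12 for `n = 1`), the extension being given by the complex boost `B(iπ/2)` — the
  one-variable content of the BHW theorem needed in §4-4. The reflected statement for the left wedge
  follows by the parity `ζ³ ↦ −ζ³` (`wedgeExtension` applied to `F ∘ P₃`, covariant under `M(−·)`).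

No Lie theory is used: the only input on `M` is the group law and holomorphy, which for
`M(w) = exp(wY)` are Mathlib facts.

## References

* R. F. Streater, A. S. Wightman, *PCT, Spin and Statistics, and All That* (1964; Princeton 2000),
  §2-4 (Thms. 2-11, 2-12, eq. (2-91): the boost of imaginary rapidity), §4-4 (eqs. (4-43)–(4-52)).
  [StreaterWightman1964]
-/

noncomputable section

open Complex Set Filter
open _root_.Topology
open scoped Real

namespace Literature.MathematicalPhysics.QuantumLattice

namespace TubeBoost

/-! ### Light-cone coordinates and the one-point tube -/

/-- The light-cone coordinate `u = ζ⁰ + ζ³`. [cite: StreaterWightman1964, §2-4] -/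
def lcU (ζ : Fin (3 + 1) → ℂ) : ℂ := ζ 0 + ζ 3

/-- The light-cone coordinate `v = ζ⁰ − ζ³`. [cite: StreaterWightman1964, §2-4] -/
def lcV (ζ : Fin (3 + 1) → ℂ) : ℂ := ζ 0 - ζ 3

/-- The squared transverse imaginary part `(Im ζ¹)² + (Im ζ²)²`. [folklore] -/
def imPerpSq (ζ : Fin (3 + 1) → ℂ) : ℝ := (ζ 1).im ^ 2 + (ζ 2).im ^ 2

/-- The **one-point upper forward tube** `T⁺ = {ζ ∈ ℂ⁴ | Im ζ ∈ V₊}` (Streater–Wightman (1964),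
§2-4, the tube `𝒯₁`; in the tree's convention of `forwardTube`, `Im ∈ V₊`).
[cite: StreaterWightman1964, §2-4] -/
def upperTube : Set (Fin (3 + 1) → ℂ) := {ζ | imPart ζ ∈ forwardCone 3}

/-- Membership in the open forward cone of `ℝ⁴` in coordinates: `p⁰ > 0` and
`(p¹)² + (p²)² + (p³)² < (p⁰)²`. [folklore] -/
theorem mem_forwardCone_three_iff (p : SpaceTime 3) :
    p ∈ forwardCone 3 ↔ 0 < p 0 ∧ p 1 ^ 2 + p 2 ^ 2 + p 3 ^ 2 < p 0 ^ 2 := by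
  rw [mem_forwardCone_iff, minkowskiForm_self, sub_pos, EuclideanSpace.norm_sq_eq]
  simp [Fin.sum_univ_three, spaceC_apply, sq_abs]

/-- **`T⁺` in light-cone coordinates**: `ζ ∈ T⁺ ↔ Im u > 0 ∧ Im v > 0 ∧ Im u · Im v > (Im ζ¹)² + (Im ζ²)²`.
[cite: StreaterWightman1964, §2-4] -/
theorem mem_upperTube_iff (ζ : Fin (3 + 1) → ℂ) :
    ζ ∈ upperTube ↔ 0 < (lcU ζ).im ∧ 0 < (lcV ζ).im ∧ imPerpSq ζ < (lcU ζ).im * (lcV ζ).im := by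
  rw [upperTube, mem_setOf_eq, mem_forwardCone_three_iff]
  simp only [imPart_apply, lcU, lcV, add_im, sub_im, imPerpSq]
  constructor
  · rintro ⟨h0, h⟩
    have h3 : (ζ 3).im ^ 2 < (ζ 0).im ^ 2 := by nlinarith [sq_nonneg (ζ 1).im, sq_nonneg (ζ 2).im]
    have h3' : |(ζ 3).im| < (ζ 0).im := abs_lt_of_sq_lt_sq h3 h0.le
    refine ⟨by linarith [(abs_lt.1 h3').1], by linarith [(abs_lt.1 h3').2], by nlinarith⟩
  · rintro ⟨hu, hv, h⟩
    refine ⟨by linarith, by nlinarith⟩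

/-! ### The complex boost in the `(0, 3)`-plane -/

/-- The **boost of complex rapidity `w` in the `(0, 3)`-plane**: `u ↦ e^{w} u`, `v ↦ e^{−w} v`,
`ζ¹, ζ²` fixed; for real `w = χ` the Lorentz boost `ζ⁰ ↦ cosh χ ζ⁰ + sinh χ ζ³`,
`ζ³ ↦ sinh χ ζ⁰ + cosh χ ζ³`, for `w = iα` Streater–Wightman's (2-91).
[cite: StreaterWightman1964, §2-4 eq. (2-91)] -/
def boost (w : ℂ) (ζ : Fin (3 + 1) → ℂ) : Fin (3 + 1) → ℂ := fun μ =>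
  if μ = 0 then (exp w * lcU ζ + exp (-w) * lcV ζ) / 2
  else if μ = 3 then (exp w * lcU ζ - exp (-w) * lcV ζ) / 2 else ζ μ

/-- `boost_apply_one`: component formula / elementary identity. [folklore] -/
@[simp] theorem boost_apply_one (w : ℂ) (ζ : Fin (3 + 1) → ℂ) : boost w ζ 1 = ζ 1 := by
  simp [boost]

/-- `boost_apply_two`: component formula / elementary identity. [folklore] -/
@[simp] theorem boost_apply_two (w : ℂ) (ζ : Fin (3 + 1) → ℂ) : boost w ζ 2 = ζ 2 := by
  simp [boost]

/-- `boost_apply_zero`: component formula / elementary identity. [folklore] -/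
theorem boost_apply_zero (w : ℂ) (ζ : Fin (3 + 1) → ℂ) :
    boost w ζ 0 = (exp w * lcU ζ + exp (-w) * lcV ζ) / 2 := by
  simp [boost]

/-- `boost_apply_three`: component formula / elementary identity. [folklore] -/
theorem boost_apply_three (w : ℂ) (ζ : Fin (3 + 1) → ℂ) :
    boost w ζ 3 = (exp w * lcU ζ - exp (-w) * lcV ζ) / 2 := by
  simp [boost]

/-- `u(B(w)ζ) = e^{w} u(ζ)`. [folklore] -/
@[simp] theorem lcU_boost (w : ℂ) (ζ : Fin (3 + 1) → ℂ) : lcU (boost w ζ) = exp w * lcU ζ := by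
  simp only [lcU, boost_apply_zero, boost_apply_three]; ring

/-- `v(B(w)ζ) = e^{−w} v(ζ)`. [folklore] -/
@[simp] theorem lcV_boost (w : ℂ) (ζ : Fin (3 + 1) → ℂ) : lcV (boost w ζ) = exp (-w) * lcV ζ := by
  simp only [lcV, boost_apply_zero, boost_apply_three]; ring

/-- The transverse imaginary part is boost invariant. [folklore] -/
@[simp] theorem imPerpSq_boost (w : ℂ) (ζ : Fin (3 + 1) → ℂ) : imPerpSq (boost w ζ) = imPerpSq ζ := by
  simp [imPerpSq]

/-- A point is determined by `u`, `v` and its components `1`, `2`. [folklore] -/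
theorem ext_lc {ζ ζ' : Fin (3 + 1) → ℂ} (hu : lcU ζ = lcU ζ') (hv : lcV ζ = lcV ζ') (h1 : ζ 1 = ζ' 1)
    (h2 : ζ 2 = ζ' 2) : ζ = ζ' := by
  have h0 : ζ 0 = ζ' 0 := by
    have := congrArg₂ (· + ·) hu hv; simp only [lcU, lcV] at this; linear_combination this / 2
  have h3 : ζ 3 = ζ' 3 := by
    have := congrArg₂ (· - ·) hu hv; simp only [lcU, lcV] at this; linear_combination this / 2
  funext μ
  fin_cases μ <;> assumption

/-- `B(0) = id`. [folklore] -/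
@[simp] theorem boost_zero (ζ : Fin (3 + 1) → ℂ) : boost 0 ζ = ζ :=
  ext_lc (by simp) (by simp) (by simp) (by simp)

/-- **The boosts form a one-parameter group**: `B(w + w') = B(w) ∘ B(w')`. [folklore] -/
theorem boost_add (w w' : ℂ) (ζ : Fin (3 + 1) → ℂ) : boost (w + w') ζ = boost w (boost w' ζ) :=
  ext_lc (by simp [exp_add]; ring) (by simp [exp_add]; ring) (by simp) (by simp)

/-- `B(−w) (B(w) ζ) = ζ`. [folklore] -/
@[simp] theorem boost_neg_boost (w : ℂ) (ζ : Fin (3 + 1) → ℂ) : boost (-w) (boost w ζ) = ζ := by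
  rw [← boost_add, neg_add_cancel, boost_zero]

/-- The boost is (jointly) continuous, indeed entire, in the rapidity: `w ↦ B(w) ζ` is
differentiable. [folklore] -/
theorem differentiable_boost_left (ζ : Fin (3 + 1) → ℂ) : Differentiable ℂ fun w => boost w ζ := by
  refine differentiable_pi.2 fun μ => ?_
  simp only [boost]
  split_ifs <;> fun_prop

/-- `ζ ↦ B(w) ζ` is complex linear, in particular differentiable. [folklore] -/
theorem differentiable_boost_right (w : ℂ) : Differentiable ℂ (boost w) := by
  refine differentiable_pi.2 fun μ => ?_
  simp only [boost, lcU, lcV]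
  split_ifs <;> fun_prop

/-- `ζ ↦ B(w) ζ` is continuous. [folklore] -/
theorem continuous_boost_right (w : ℂ) : Continuous (boost w) :=
  (differentiable_boost_right w).continuous

/-- **Real boosts preserve the tube.** [cite: StreaterWightman1964, §2-4] -/
theorem boost_ofReal_mem_upperTube {ζ : Fin (3 + 1) → ℂ} (hζ : ζ ∈ upperTube) (χ : ℝ) :
    boost χ ζ ∈ upperTube := by
  rw [mem_upperTube_iff] at hζ ⊢
  obtain ⟨hu, hv, h⟩ := hζ
  have heu : exp (χ : ℂ) = (Real.exp χ : ℂ) := (Complex.ofReal_exp χ).symm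
  have hev : exp (-(χ : ℂ)) = (Real.exp (-χ) : ℂ) := by rw [← Complex.ofReal_neg, Complex.ofReal_exp]
  simp only [lcU_boost, lcV_boost, imPerpSq_boost, heu, hev, Complex.im_ofReal_mul]
  refine ⟨mul_pos (Real.exp_pos _) hu, mul_pos (Real.exp_pos _) hv, ?_⟩
  calc imPerpSq ζ < (lcU ζ).im * (lcV ζ).im := h
    _ = Real.exp χ * (lcU ζ).im * (Real.exp (-χ) * (lcV ζ).im) := by
        rw [Real.exp_neg]; field_simp

/-- Real boosts act on the tube as bijections: `B(χ) ζ ∈ T⁺ ↔ ζ ∈ T⁺`. [folklore] -/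
theorem boost_ofReal_mem_upperTube_iff (ζ : Fin (3 + 1) → ℂ) (χ : ℝ) :
    boost χ ζ ∈ upperTube ↔ ζ ∈ upperTube := by
  refine ⟨fun h => ?_, fun h => boost_ofReal_mem_upperTube h χ⟩
  have h' := boost_ofReal_mem_upperTube h (-χ)
  rwa [Complex.ofReal_neg, boost_neg_boost] at h'

/-- The tube is open. [folklore] -/
theorem isOpen_upperTube : IsOpen upperTube := by
  have h : upperTube = {ζ : Fin (3 + 1) → ℂ | 0 < (lcU ζ).im} ∩ {ζ | 0 < (lcV ζ).im} ∩
      {ζ | imPerpSq ζ < (lcU ζ).im * (lcV ζ).im} := by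
    ext ζ; simp only [mem_upperTube_iff, mem_inter_iff, mem_setOf_eq, and_assoc]
  rw [h]
  have hu : Continuous fun ζ : Fin (3 + 1) → ℂ => (lcU ζ).im :=
    Complex.continuous_im.comp ((continuous_apply 0).add (continuous_apply 3))
  have hv : Continuous fun ζ : Fin (3 + 1) → ℂ => (lcV ζ).im :=
    Complex.continuous_im.comp ((continuous_apply 0).sub (continuous_apply 3))
  have hp : Continuous fun ζ : Fin (3 + 1) → ℂ => imPerpSq ζ :=
    ((Complex.continuous_im.comp (continuous_apply 1)).pow 2).add
      ((Complex.continuous_im.comp (continuous_apply 2)).pow 2)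
  exact ((isOpen_lt continuous_const hu).inter (isOpen_lt continuous_const hv)).inter
    (isOpen_lt hp (hu.mul hv))

/-! ### The imaginary parts along a complex boost orbit -/

section Orbit

variable {ζ₀ : Fin (3 + 1) → ℂ}

/-- Polar form of the boosted `u`: `e^{w} u₀ = ‖u₀‖ e^{w + i arg u₀}`. [folklore] -/
theorem exp_mul_eq_norm_mul_exp (w u : ℂ) : exp w * u = (‖u‖ : ℂ) * exp (w + (arg u : ℂ) * I) := by
  conv_lhs => rw [← norm_mul_exp_arg_mul_I u]
  rw [exp_add]; ring

/-- `Im (e^{w} u₀) = ‖u₀‖ e^{Re w} sin (arg u₀ + Im w)`. [folklore] -/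
theorem im_lcU_boost (w : ℂ) (ζ₀ : Fin (3 + 1) → ℂ) :
    (lcU (boost w ζ₀)).im = ‖lcU ζ₀‖ * Real.exp w.re * Real.sin (arg (lcU ζ₀) + w.im) := by
  rw [lcU_boost, exp_mul_eq_norm_mul_exp, im_ofReal_mul, exp_im]
  simp [add_comm, mul_assoc]

/-- `Im (e^{−w} v₀) = ‖v₀‖ e^{−Re w} sin (arg v₀ − Im w)`. [folklore] -/
theorem im_lcV_boost (w : ℂ) (ζ₀ : Fin (3 + 1) → ℂ) :
    (lcV (boost w ζ₀)).im = ‖lcV ζ₀‖ * Real.exp (-w.re) * Real.sin (arg (lcV ζ₀) - w.im) := by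
  rw [lcV_boost, exp_mul_eq_norm_mul_exp, im_ofReal_mul, exp_im]
  simp [sub_eq_neg_add, mul_assoc]

/-- **The product `Im u · Im v` along the orbit**:
`Im u(w) · Im v(w) = ‖u₀‖ ‖v₀‖ (cos (arg u₀ − arg v₀ + 2 Im w) − cos (arg u₀ + arg v₀)) / 2`.
[folklore] -/
theorem im_lcU_mul_im_lcV_boost (w : ℂ) (ζ₀ : Fin (3 + 1) → ℂ) :
    (lcU (boost w ζ₀)).im * (lcV (boost w ζ₀)).im = ‖lcU ζ₀‖ * ‖lcV ζ₀‖ *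
      ((Real.cos (arg (lcU ζ₀) - arg (lcV ζ₀) + 2 * w.im) - Real.cos (arg (lcU ζ₀) + arg (lcV ζ₀))) / 2) := by
  rw [im_lcU_boost, im_lcV_boost, Real.cos_sub_cos]
  have h : Real.exp w.re * Real.exp (-w.re) = 1 := by rw [← Real.exp_add, add_neg_cancel, Real.exp_zero]
  have e1 : (arg (lcU ζ₀) - arg (lcV ζ₀) + 2 * w.im + (arg (lcU ζ₀) + arg (lcV ζ₀))) / 2 =
      arg (lcU ζ₀) + w.im := by ring
  have e2 : (arg (lcU ζ₀) - arg (lcV ζ₀) + 2 * w.im - (arg (lcU ζ₀) + arg (lcV ζ₀))) / 2 =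
      -(arg (lcV ζ₀) - w.im) := by ring
  rw [e1, e2, Real.sin_neg]
  linear_combination (‖lcU ζ₀‖ * ‖lcV ζ₀‖ * Real.sin (arg (lcU ζ₀) + w.im) *
    Real.sin (arg (lcV ζ₀) - w.im)) * h

/-- The angle `ψ(w) = arg u₀ − arg v₀ + 2 Im w` of the orbit. [folklore] -/
def orbitAngle (ζ₀ : Fin (3 + 1) → ℂ) (w : ℂ) : ℝ := arg (lcU ζ₀) - arg (lcV ζ₀) + 2 * w.im

/-- `arg u₀ + Im w = (σ + ψ)/2` with `σ = arg u₀ + arg v₀`. [folklore] -/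
theorem arg_lcU_add_im (ζ₀ : Fin (3 + 1) → ℂ) (w : ℂ) :
    arg (lcU ζ₀) + w.im = (arg (lcU ζ₀) + arg (lcV ζ₀) + orbitAngle ζ₀ w) / 2 := by
  simp only [orbitAngle]; ring

/-- `arg v₀ − Im w = (σ − ψ)/2`. [folklore] -/
theorem arg_lcV_sub_im (ζ₀ : Fin (3 + 1) → ℂ) (w : ℂ) :
    arg (lcV ζ₀) - w.im = (arg (lcU ζ₀) + arg (lcV ζ₀) - orbitAngle ζ₀ w) / 2 := by
  simp only [orbitAngle]; ring

/-- For a point of the tube, `u₀` and `v₀` have arguments in `(0, π)`. [folklore] -/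
theorem arg_lcU_mem_Ioo (hζ₀ : ζ₀ ∈ upperTube) : arg (lcU ζ₀) ∈ Ioo 0 π := by
  have hu : 0 < (lcU ζ₀).im := ((mem_upperTube_iff ζ₀).1 hζ₀).1
  refine ⟨lt_of_le_of_ne (arg_nonneg_iff.2 hu.le) (fun h => ?_), lt_of_le_of_ne (arg_le_pi _) fun h => ?_⟩
  · exact hu.ne' (arg_eq_zero_iff.1 h.symm).2
  · exact hu.ne' (arg_eq_pi_iff.1 h).2

/-- For a point of the tube, `v₀` has argument in `(0, π)`. [folklore] -/
theorem arg_lcV_mem_Ioo (hζ₀ : ζ₀ ∈ upperTube) : arg (lcV ζ₀) ∈ Ioo 0 π := by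
  have hv : 0 < (lcV ζ₀).im := ((mem_upperTube_iff ζ₀).1 hζ₀).2.1
  refine ⟨lt_of_le_of_ne (arg_nonneg_iff.2 hv.le) (fun h => ?_), lt_of_le_of_ne (arg_le_pi _) fun h => ?_⟩
  · exact hv.ne' (arg_eq_zero_iff.1 h.symm).2
  · exact hv.ne' (arg_eq_pi_iff.1 h).2

/-- `u₀ ≠ 0` on the tube. [folklore] -/
theorem lcU_ne_zero (hζ₀ : ζ₀ ∈ upperTube) : lcU ζ₀ ≠ 0 := fun h => by
  have hu : 0 < (lcU ζ₀).im := ((mem_upperTube_iff ζ₀).1 hζ₀).1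
  rw [h, zero_im] at hu; exact lt_irrefl _ hu

/-- `v₀ ≠ 0` on the tube. [folklore] -/
theorem lcV_ne_zero (hζ₀ : ζ₀ ∈ upperTube) : lcV ζ₀ ≠ 0 := fun h => by
  have hv : 0 < (lcV ζ₀).im := ((mem_upperTube_iff ζ₀).1 hζ₀).2.1
  rw [h, zero_im] at hv; exact lt_irrefl _ hv

/-- `sin x > 0` with `x ∈ (−π, 2π)` forces `x ∈ (0, π)`. [folklore] -/
theorem mem_Ioo_of_sin_pos {x : ℝ} (hx : 0 < Real.sin x) (h1 : -π < x) (h2 : x < 2 * π) :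
    x ∈ Ioo 0 π := by
  by_contra h
  rw [mem_Ioo, not_and_or, not_lt, not_lt] at h
  rcases h with h | h
  · exact absurd hx (not_lt.2 (Real.sin_nonpos_of_nonpos_of_neg_pi_le h h1.le))
  · have : Real.sin x ≤ 0 := by
      rw [← Real.sin_sub_two_pi]
      exact Real.sin_nonpos_of_nonpos_of_neg_pi_le (by linarith) (by linarith)
    exact absurd hx (not_lt.2 this)

/-- **Monotonicity of the tube condition along a complex boost orbit**: if `B(w₁)ζ₀ ∈ T⁺` with
`|ψ(w₁)| < π`, and `|ψ(w)| ≤ |ψ(w₁)|`, then `B(w)ζ₀ ∈ T⁺` (the conditions `Im u, Im v > 0` read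
`|ψ| < min(σ, 2π − σ)` and the condition `Im u Im v > ρ²` reads `cos ψ > cos σ + 2ρ²/(‖u₀‖‖v₀‖)`;
both are monotone in `|ψ|`). [folklore] -/
theorem boost_mem_upperTube_of_abs_orbitAngle_le (hζ₀ : ζ₀ ∈ upperTube) {w₁ w : ℂ}
    (h₁ : boost w₁ ζ₀ ∈ upperTube) (hπ : |orbitAngle ζ₀ w₁| < π)
    (hle : |orbitAngle ζ₀ w| ≤ |orbitAngle ζ₀ w₁|) : boost w ζ₀ ∈ upperTube := by
  set α := arg (lcU ζ₀) with hα
  set β := arg (lcV ζ₀) with hβ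
  set ψ₁ := orbitAngle ζ₀ w₁ with hψ₁
  set ψ := orbitAngle ζ₀ w with hψ
  have hαm := arg_lcU_mem_Ioo hζ₀
  have hβm := arg_lcV_mem_Ioo hζ₀
  rw [← hα] at hαm; rw [← hβ] at hβm
  have hnu : 0 < ‖lcU ζ₀‖ := norm_pos_iff.2 (lcU_ne_zero hζ₀)
  have hnv : 0 < ‖lcV ζ₀‖ := norm_pos_iff.2 (lcV_ne_zero hζ₀)
  rw [mem_upperTube_iff] at h₁ ⊢
  obtain ⟨hu₁, hv₁, hp₁⟩ := h₁
  rw [im_lcU_boost, arg_lcU_add_im, ← hα, ← hβ, ← hψ₁] at hu₁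
  rw [im_lcV_boost, arg_lcV_sub_im, ← hα, ← hβ, ← hψ₁] at hv₁
  rw [im_lcU_mul_im_lcV_boost, imPerpSq_boost, ← hα, ← hβ] at hp₁
  change imPerpSq ζ₀ < ‖lcU ζ₀‖ * ‖lcV ζ₀‖ * ((Real.cos ψ₁ - Real.cos (α + β)) / 2) at hp₁
  -- the sign conditions at `w₁` give `|ψ₁| < min σ (2π - σ)`
  have hs₁ : 0 < Real.sin ((α + β + ψ₁) / 2) :=
    (mul_pos_iff_of_pos_left (mul_pos hnu (Real.exp_pos _))).1 hu₁
  have ht₁ : 0 < Real.sin ((α + β - ψ₁) / 2) :=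
    (mul_pos_iff_of_pos_left (mul_pos hnv (Real.exp_pos _))).1 hv₁
  have hψ₁abs := abs_lt.1 hπ
  have hI₁ := mem_Ioo_of_sin_pos hs₁ (by linarith [hαm.1, hβm.1]) (by linarith [hαm.2, hβm.2])
  have hJ₁ := mem_Ioo_of_sin_pos ht₁ (by linarith [hαm.1, hβm.1]) (by linarith [hαm.2, hβm.2])
  -- hence at `w`
  have hψabs : |ψ| < π := hle.trans_lt hπ
  have hψ' := abs_lt.1 hψabs
  have habs : -|ψ₁| ≤ ψ ∧ ψ ≤ |ψ₁| := abs_le.1 hle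
  have hI₁' := hI₁; have hJ₁' := hJ₁
  rw [mem_Ioo] at hI₁' hJ₁'
  have hI : (α + β + ψ) / 2 ∈ Ioo 0 π := by
    rcases le_or_gt 0 ψ₁ with h | h
    · rw [abs_of_nonneg h] at habs; constructor <;> linarith
    · rw [abs_of_neg h] at habs; constructor <;> linarith
  have hJ : (α + β - ψ) / 2 ∈ Ioo 0 π := by
    rcases le_or_gt 0 ψ₁ with h | h
    · rw [abs_of_nonneg h] at habs; constructor <;> linarith
    · rw [abs_of_neg h] at habs; constructor <;> linarith
  refine ⟨?_, ?_, ?_⟩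
  · rw [im_lcU_boost, arg_lcU_add_im, ← hα, ← hβ, ← hψ]
    exact mul_pos (mul_pos hnu (Real.exp_pos _)) (Real.sin_pos_of_pos_of_lt_pi hI.1 hI.2)
  · rw [im_lcV_boost, arg_lcV_sub_im, ← hα, ← hβ, ← hψ]
    exact mul_pos (mul_pos hnv (Real.exp_pos _)) (Real.sin_pos_of_pos_of_lt_pi hJ.1 hJ.2)
  · rw [im_lcU_mul_im_lcV_boost, imPerpSq_boost, ← hα, ← hβ]
    change imPerpSq ζ₀ < ‖lcU ζ₀‖ * ‖lcV ζ₀‖ * ((Real.cos ψ - Real.cos (α + β)) / 2)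
    have hcos : Real.cos ψ₁ ≤ Real.cos ψ := by
      rw [← Real.cos_abs ψ₁, ← Real.cos_abs ψ]
      exact Real.cos_le_cos_of_nonneg_of_le_pi (abs_nonneg _) hπ.le hle
    have hmono : ‖lcU ζ₀‖ * ‖lcV ζ₀‖ * ((Real.cos ψ₁ - Real.cos (α + β)) / 2) ≤
        ‖lcU ζ₀‖ * ‖lcV ζ₀‖ * ((Real.cos ψ - Real.cos (α + β)) / 2) := by
      have := mul_pos hnu hnv
      nlinarith
    exact hp₁.trans_le hmono

/-! ### The domain of complex rapidities -/

/-- The **domain of complex rapidities** at `ζ₀ ∈ T⁺`: those `w` with `B(w)ζ₀ ∈ T⁺` and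
`|arg u₀ − arg v₀ + 2 Im w| < π` (the connected component of `{w | B(w)ζ₀ ∈ T⁺}` containing `0`,
a horizontal strip). [folklore] -/
def boostDomain (ζ₀ : Fin (3 + 1) → ℂ) : Set ℂ := {w | boost w ζ₀ ∈ upperTube ∧ |orbitAngle ζ₀ w| < π}

/-- `0` is in the domain. [folklore] -/
theorem zero_mem_boostDomain (hζ₀ : ζ₀ ∈ upperTube) : (0 : ℂ) ∈ boostDomain ζ₀ := by
  refine ⟨by rwa [boost_zero], ?_⟩
  have hα := arg_lcU_mem_Ioo hζ₀
  have hβ := arg_lcV_mem_Ioo hζ₀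
  simp only [orbitAngle, zero_im, mul_zero, add_zero]
  rw [abs_lt]; constructor <;> linarith [hα.1, hα.2, hβ.1, hβ.2]

/-- The domain is invariant under real translations of the rapidity. [folklore] -/
theorem add_ofReal_mem_boostDomain {w : ℂ} (hw : w ∈ boostDomain ζ₀) (χ : ℝ) :
    w + χ ∈ boostDomain ζ₀ := by
  refine ⟨?_, ?_⟩
  · rw [show w + (χ : ℂ) = (χ : ℂ) + w from add_comm _ _, boost_add]
    exact boost_ofReal_mem_upperTube hw.1 χ
  · have : orbitAngle ζ₀ (w + χ) = orbitAngle ζ₀ w := by simp [orbitAngle]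
    rw [this]; exact hw.2

/-- The domain is open. [folklore] -/
theorem isOpen_boostDomain (ζ₀ : Fin (3 + 1) → ℂ) : IsOpen (boostDomain ζ₀) := by
  refine (isOpen_upperTube.preimage (differentiable_boost_left ζ₀).continuous).inter ?_
  have hc : Continuous fun w : ℂ => |orbitAngle ζ₀ w| :=
    (continuous_const.add (continuous_const.mul Complex.continuous_im)).abs
  exact isOpen_lt hc continuous_const

/-- **The domain of complex rapidities is convex** (a strip `ℝ × (b₋, b₊)`): the angle
`ψ(w) = arg u₀ − arg v₀ + 2 Im w` is affine in `w` and the tube condition is monotone in `|ψ|`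
(`boost_mem_upperTube_of_abs_orbitAngle_le`). [folklore] -/
theorem convex_boostDomain (hζ₀ : ζ₀ ∈ upperTube) : Convex ℝ (boostDomain ζ₀) := by
  intro w₁ hw₁ w₂ hw₂ a b ha hb hab
  have haff : orbitAngle ζ₀ (a • w₁ + b • w₂) = a * orbitAngle ζ₀ w₁ + b * orbitAngle ζ₀ w₂ := by
    simp only [orbitAngle, add_im, smul_im, smul_eq_mul]
    linear_combination (-(arg (lcU ζ₀) - arg (lcV ζ₀))) * hab
  have hle : |orbitAngle ζ₀ (a • w₁ + b • w₂)| ≤ max |orbitAngle ζ₀ w₁| |orbitAngle ζ₀ w₂| := by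
    rw [haff]
    calc |a * orbitAngle ζ₀ w₁ + b * orbitAngle ζ₀ w₂|
        ≤ |a * orbitAngle ζ₀ w₁| + |b * orbitAngle ζ₀ w₂| := abs_add_le _ _
      _ = a * |orbitAngle ζ₀ w₁| + b * |orbitAngle ζ₀ w₂| := by
          rw [abs_mul, abs_mul, abs_of_nonneg ha, abs_of_nonneg hb]
      _ ≤ a * max |orbitAngle ζ₀ w₁| |orbitAngle ζ₀ w₂| + b * max |orbitAngle ζ₀ w₁| |orbitAngle ζ₀ w₂| :=
          add_le_add (mul_le_mul_of_nonneg_left (le_max_left _ _) ha)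
            (mul_le_mul_of_nonneg_left (le_max_right _ _) hb)
      _ = max |orbitAngle ζ₀ w₁| |orbitAngle ζ₀ w₂| := by rw [← add_mul, hab, one_mul]
  rcases le_total |orbitAngle ζ₀ w₁| |orbitAngle ζ₀ w₂| with h | h
  · rw [max_eq_right h] at hle
    exact ⟨boost_mem_upperTube_of_abs_orbitAngle_le hζ₀ hw₂.1 hw₂.2 hle, hle.trans_lt hw₂.2⟩
  · rw [max_eq_left h] at hle
    exact ⟨boost_mem_upperTube_of_abs_orbitAngle_le hζ₀ hw₁.1 hw₁.2 hle, hle.trans_lt hw₁.2⟩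

end Orbit

/-! ### Complex boost covariance inside the tube -/

section Covariance

variable {E : Type*} [NormedAddCommGroup E] [NormedSpace ℂ E]

/-- A function of a complex variable which is invariant under small real translations at a point
and complex differentiable there has derivative zero there. [folklore] -/
theorem hasDerivAt_zero_of_real_periodic {φ : ℂ → E} {w : ℂ} {φ' : E} (hφ : HasDerivAt φ φ' w)
    (hper : ∀ χ : ℝ, φ (w + χ) = φ w) : φ' = 0 := by
  have h1 : HasDerivAt (fun z : ℂ => φ (w + z)) φ' ((0 : ℝ) : ℂ) := by
    rw [Complex.ofReal_zero]
    have : HasDerivAt φ φ' (w + 0) := by rwa [add_zero]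
    exact this.comp_const_add w 0
  -- restrict to the real line
  have h2 : HasFDerivAt (fun y : ℝ => φ (w + (y : ℂ)))
      (((ContinuousLinearMap.smulRight (1 : ℂ →L[ℂ] ℂ) φ').restrictScalars ℝ).comp Complex.ofRealCLM) 0 :=
    (h1.hasFDerivAt.restrictScalars ℝ).comp (0 : ℝ) Complex.ofRealCLM.hasFDerivAt
  have h3 : HasFDerivAt (fun y : ℝ => φ (w + (y : ℂ))) (0 : ℝ →L[ℝ] E) 0 := by
    have : (fun y : ℝ => φ (w + (y : ℂ))) = fun _ => φ w := funext hper
    rw [this]; exact hasFDerivAt_const _ _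
  have h4 := congrArg (fun L : ℝ →L[ℝ] E => L 1) (h2.unique h3)
  simpa using h4

/-- **Complex boost covariance inside the tube** (the one-variable, one-parameter substitute for the
Bargmann–Hall–Wightman theorem, Streater–Wightman (1964), Thm. 2-11, as used for (4-51)): let `F`
be holomorphic on `T⁺` and covariant under the real boosts, `F(B(χ)ζ) = M(χ) F(ζ)`, for an entire
one-parameter group `M`. Then `F(B(w)ζ₀) = M(w) F(ζ₀)` for every `ζ₀ ∈ T⁺` and every complex
rapidity `w` in the (convex) domain `boostDomain ζ₀`. Proof: `φ(w) = M(−w) F(B(w)ζ₀)` is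
holomorphic on the domain and invariant under real translations of `w` (group law and real
covariance), hence has zero derivative, hence is constant on the convex domain (mean value
inequality), and `φ(0) = F(ζ₀)`. [cite: StreaterWightman1964, §2-4 Thm 2-11; §4-4 eq. (4-51)] -/
theorem boost_covariance_complex {F : (Fin (3 + 1) → ℂ) → E} (hF : DifferentiableOn ℂ F upperTube)
    {M : ℂ → E →L[ℂ] E} (hM : Differentiable ℂ M) (hM0 : M 0 = 1)
    (hMadd : ∀ a b, M (a + b) = M a * M b)
    (hcov : ∀ (χ : ℝ), ∀ ζ ∈ upperTube, F (boost χ ζ) = M χ (F ζ))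
    {ζ₀ : Fin (3 + 1) → ℂ} (hζ₀ : ζ₀ ∈ upperTube) {w : ℂ} (hw : w ∈ boostDomain ζ₀) :
    F (boost w ζ₀) = M w (F ζ₀) := by
  set φ : ℂ → E := fun z => M (-z) (F (boost z ζ₀)) with hφdef
  -- `φ` is differentiable on the domain
  have hdiff : ∀ z ∈ boostDomain ζ₀, DifferentiableAt ℂ φ z := by
    intro z hz
    have h1 : DifferentiableAt ℂ (fun z => M (-z)) z := (hM.comp differentiable_neg).differentiableAt
    have h2 : DifferentiableAt ℂ (fun z => F (boost z ζ₀)) z :=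
      (hF.differentiableAt (isOpen_upperTube.mem_nhds hz.1)).comp z
        (differentiable_boost_left ζ₀).differentiableAt
    exact h1.clm_apply h2
  -- `φ` is invariant under real translations, hence has zero derivative
  have hper : ∀ z ∈ boostDomain ζ₀, ∀ χ : ℝ, φ (z + χ) = φ z := by
    intro z hz χ
    simp only [hφdef]
    rw [show z + (χ : ℂ) = (χ : ℂ) + z from add_comm _ _, boost_add, hcov χ _ hz.1,
      show M (-((χ : ℂ) + z)) (M χ (F (boost z ζ₀))) = (M (-((χ : ℂ) + z)) * M χ) (F (boost z ζ₀))
        from rfl, ← hMadd]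
    congr 2; ring
  have hderiv : ∀ z ∈ boostDomain ζ₀, HasDerivWithinAt φ ((fun _ => (0 : E)) z) (boostDomain ζ₀) z := by
    intro z hz
    have h := (hdiff z hz).hasDerivAt
    have h0 : deriv φ z = 0 := hasDerivAt_zero_of_real_periodic h (hper z hz)
    rw [h0] at h
    exact h.hasDerivWithinAt
  -- hence `φ` is constant on the convex domain
  have hconst := (convex_boostDomain hζ₀).norm_image_sub_le_of_norm_hasDerivWithin_le (C := 0) hderiv
    (fun _ _ => by simp) (zero_mem_boostDomain hζ₀) hw
  rw [zero_mul, norm_le_zero_iff, sub_eq_zero] at hconst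
  simp only [hφdef, neg_zero, hM0, boost_zero, ContinuousLinearMap.one_def,
    ContinuousLinearMap.id_apply] at hconst
  -- `F(B(w)ζ₀) = M(w) M(−w) F(B(w)ζ₀) = M(w) F(ζ₀)`
  have hinv : M w * M (-w) = 1 := by rw [← hMadd, add_neg_cancel, hM0]
  calc F (boost w ζ₀) = (M w * M (-w)) (F (boost w ζ₀)) := by rw [hinv]; rfl
    _ = M w (M (-w) (F (boost w ζ₀))) := rfl
    _ = M w (F ζ₀) := by rw [hconst]

end Covariance

/-! ### Continuation across the right spacelike wedge -/

section Wedge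

variable {E : Type*} [NormedAddCommGroup E] [NormedSpace ℂ E]

/-- `e^{iπ/2} = i`. [folklore] -/
theorem exp_pi_div_two_mul_I : exp (π / 2 * I) = I := by
  rw [show (π / 2 * I : ℂ) = ((π / 2 : ℝ) : ℂ) * I by push_cast; ring, exp_mul_I]
  simp [Complex.cos_pi_div_two, Complex.sin_pi_div_two]

/-- `e^{−iπ/2} = −i`. [folklore] -/
theorem exp_neg_pi_div_two_mul_I : exp (-(π / 2 * I)) = -I := by
  have h : exp (π / 2 * I) * exp (-(π / 2 * I)) = 1 := by rw [← exp_add, add_neg_cancel, exp_zero]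
  rw [exp_pi_div_two_mul_I] at h
  have hI : I * (-I) = 1 := by rw [mul_neg, I_mul_I, neg_neg]
  calc exp (-(π / 2 * I)) = (I * (-I)) * exp (-(π / 2 * I)) := by rw [hI, one_mul]
    _ = -I * (I * exp (-(π / 2 * I))) := by ring
    _ = -I := by rw [h, mul_one]

/-- The **right-wedge domain**: points `ζ` whose quarter-turn boost `B(iπ/2)ζ` lies in `T⁺` and
with `Re u > 0 > Re v`. An open neighbourhood of the real spacelike wedge `{ξ³ > |ξ⁰|}`
(`complexifyPoint_mem_wedgeDomain`). [folklore] -/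
def wedgeDomain : Set (Fin (3 + 1) → ℂ) :=
  {ζ | boost (π / 2 * I) ζ ∈ upperTube ∧ 0 < (lcU ζ).re ∧ (lcV ζ).re < 0}

/-- The wedge domain is open. [folklore] -/
theorem isOpen_wedgeDomain : IsOpen wedgeDomain := by
  have h : wedgeDomain = boost (π / 2 * I) ⁻¹' upperTube ∩ {ζ | 0 < (lcU ζ).re} ∩ {ζ | (lcV ζ).re < 0} := by
    ext ζ; simp only [wedgeDomain, mem_inter_iff, mem_preimage, mem_setOf_eq, and_assoc]
  rw [h]
  refine ((isOpen_upperTube.preimage (continuous_boost_right _)).inter ?_).inter ?_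
  · exact isOpen_lt continuous_const
      (Complex.continuous_re.comp ((continuous_apply 0).add (continuous_apply 3)))
  · exact isOpen_lt (Complex.continuous_re.comp ((continuous_apply 0).sub (continuous_apply 3)))
      continuous_const

/-- **The real spacelike wedge `{ξ³ > |ξ⁰|}` lies in the wedge domain** (Streater–Wightman (1964),
Thm. 2-12 for `n = 1`, in the form adapted to the boost: the boost of imaginary rapidity `iπ/2`
takes `ξ` into the tube, eq. (2-91)). [cite: StreaterWightman1964, §2-4 Thm 2-12 eq. (2-91)] -/
theorem complexifyPoint_mem_wedgeDomain {ξ : SpaceTime 3} (hξ : |ξ 0| < ξ 3) :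
    complexifyPoint ξ ∈ wedgeDomain := by
  have h := abs_lt.1 hξ
  have hu : lcU (complexifyPoint ξ) = ((ξ 0 + ξ 3 : ℝ) : ℂ) := by simp [lcU]
  have hv : lcV (complexifyPoint ξ) = ((ξ 0 - ξ 3 : ℝ) : ℂ) := by simp [lcV]
  refine ⟨?_, ?_, ?_⟩
  · rw [mem_upperTube_iff, lcU_boost, lcV_boost, imPerpSq_boost, exp_pi_div_two_mul_I,
      exp_neg_pi_div_two_mul_I, hu, hv]
    simp only [I_mul_im, neg_mul, neg_im, ofReal_re, imPerpSq, complexifyPoint_apply, ofReal_im]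
    refine ⟨by linarith, by linarith, by nlinarith⟩
  · rw [hu, ofReal_re]; linarith
  · rw [hv, ofReal_re]; linarith

variable (M : ℂ → E →L[ℂ] E) (F : (Fin (3 + 1) → ℂ) → E)

/-- The **wedge extension** `F♯(ζ) = M(−iπ/2) F(B(iπ/2) ζ)` of a boost-covariant function on the
tube: the candidate continuation of `F` across the right spacelike wedge, by the complex boost of
rapidity `iπ/2` (Streater–Wightman (1964), §2-4, eq. (2-91) and Thm. 2-11).
[cite: StreaterWightman1964, §2-4 Thm 2-11] -/
def wedgeExtension (ζ : Fin (3 + 1) → ℂ) : E := M (-(π / 2 * I)) (F (boost (π / 2 * I) ζ))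

variable {M F}

/-- **The wedge extension is holomorphic on the wedge domain.** [folklore] -/
theorem differentiableOn_wedgeExtension (hF : DifferentiableOn ℂ F upperTube) :
    DifferentiableOn ℂ (wedgeExtension M F) wedgeDomain := by
  intro ζ hζ
  have h1 : DifferentiableAt ℂ (fun ζ => F (boost (π / 2 * I) ζ)) ζ :=
    (hF.differentiableAt (isOpen_upperTube.mem_nhds hζ.1)).comp ζ
      (differentiable_boost_right _).differentiableAt
  exact ((M (-(π / 2 * I))).differentiableAt.comp ζ h1).differentiableWithinAt

/-- In the wedge domain, a point of the tube has `arg u ∈ (0, π/2)` and `arg v ∈ (π/2, π)`, so that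
`iπ/2` lies in its domain of complex rapidities. [folklore] -/
theorem pi_div_two_mul_I_mem_boostDomain {ζ : Fin (3 + 1) → ℂ} (hζ : ζ ∈ wedgeDomain)
    (hζ' : ζ ∈ upperTube) : (π / 2 : ℝ) * I ∈ boostDomain ζ := by
  have hw : ((π / 2 : ℝ) : ℂ) * I = π / 2 * I := by push_cast; ring
  refine ⟨by rw [hw]; exact hζ.1, ?_⟩
  obtain ⟨-, hur, hvr⟩ := hζ
  obtain ⟨hui, hvi, -⟩ := (mem_upperTube_iff ζ).1 hζ'
  -- quadrants
  have hu1 : 0 < arg (lcU ζ) := lt_of_le_of_ne (arg_nonneg_iff.2 hui.le)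
    fun h => hui.ne' (arg_eq_zero_iff.1 h.symm).2
  have hu2 : arg (lcU ζ) < π / 2 := arg_lt_pi_div_two_iff.2 (Or.inl hur)
  have hv1 : π / 2 < arg (lcV ζ) := by
    by_contra h
    rcases arg_le_pi_div_two_iff.1 (not_lt.1 h) with h' | h'
    · exact absurd hvr (not_lt.2 h')
    · exact absurd hvi (not_lt.2 h'.le)
  have hv2 : arg (lcV ζ) < π := lt_of_le_of_ne (arg_le_pi _) fun h => hvi.ne' (arg_eq_pi_iff.1 h).2
  simp only [orbitAngle, mul_im, ofReal_re, I_im, mul_one, ofReal_im, I_re, mul_zero, add_zero]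
  rw [abs_lt]; constructor <;> linarith

/-- **The wedge extension agrees with `F` on the tube**: for `ζ` in the wedge domain and in `T⁺`,
`F♯(ζ) = F(ζ)` (complex boost covariance at rapidity `iπ/2`). Hence `F♯` is a holomorphic
continuation of `F|_{T⁺ ∩ 𝒩}` to the neighbourhood `𝒩 = wedgeDomain` of the real spacelike wedge
(Streater–Wightman (1964), Thms. 2-11, 2-12 for one vector and the boosts).
[cite: StreaterWightman1964, §2-4 Thms 2-11, 2-12] -/
theorem wedgeExtension_eq_of_mem_upperTube (hF : DifferentiableOn ℂ F upperTube)
    (hM : Differentiable ℂ M) (hM0 : M 0 = 1) (hMadd : ∀ a b, M (a + b) = M a * M b)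
    (hcov : ∀ (χ : ℝ), ∀ ζ ∈ upperTube, F (boost χ ζ) = M χ (F ζ))
    {ζ : Fin (3 + 1) → ℂ} (hζ : ζ ∈ wedgeDomain) (hζ' : ζ ∈ upperTube) :
    wedgeExtension M F ζ = F ζ := by
  have hw : ((π / 2 : ℝ) : ℂ) * I = π / 2 * I := by push_cast; ring
  have h := boost_covariance_complex hF hM hM0 hMadd hcov hζ'
    (pi_div_two_mul_I_mem_boostDomain hζ hζ')
  rw [hw] at h
  rw [wedgeExtension, h]
  change (M (-(π / 2 * I)) * M (π / 2 * I)) (F ζ) = F ζ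
  rw [← hMadd, neg_add_cancel, hM0]
  rfl

/-- **Boundary values on the wedge are the values of the extension**: if `ζₙ → ξ` within `T⁺`,
`ξ` in the wedge domain (e.g. a real point of the spacelike wedge), then `F(ζₙ) → F♯(ξ)`.
[cite: StreaterWightman1964, §4-4 proof of Thm 4-9] -/
theorem tendsto_wedgeExtension (hF : DifferentiableOn ℂ F upperTube)
    (hM : Differentiable ℂ M) (hM0 : M 0 = 1) (hMadd : ∀ a b, M (a + b) = M a * M b)
    (hcov : ∀ (χ : ℝ), ∀ ζ ∈ upperTube, F (boost χ ζ) = M χ (F ζ))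
    {ξ : Fin (3 + 1) → ℂ} (hξ : ξ ∈ wedgeDomain) :
    Tendsto F (𝓝[upperTube] ξ) (𝓝 (wedgeExtension M F ξ)) := by
  have hcont : ContinuousAt (wedgeExtension M F) ξ :=
    ((differentiableOn_wedgeExtension hF).differentiableAt (isOpen_wedgeDomain.mem_nhds hξ)).continuousAt
  have h1 : Tendsto (wedgeExtension M F) (𝓝[upperTube] ξ) (𝓝 (wedgeExtension M F ξ)) :=
    hcont.tendsto.mono_left nhdsWithin_le_nhds
  refine h1.congr' ?_
  filter_upwards [mem_nhdsWithin_of_mem_nhds (isOpen_wedgeDomain.mem_nhds hξ), self_mem_nhdsWithin]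
    with ζ h₁ h₂
  exact wedgeExtension_eq_of_mem_upperTube hF hM hM0 hMadd hcov h₁ h₂

/-! ### Symmetries: the rotation by `π` about the third axis and the parity `ζ³ ↦ −ζ³` -/

/-- The rotation by `π` about the third axis, `(ζ⁰, ζ¹, ζ², ζ³) ↦ (ζ⁰, −ζ¹, −ζ², ζ³)` (the Lorentz
transformation `Λ(diag(i, −i))`). [folklore] -/
def rot3 (ζ : Fin (3 + 1) → ℂ) : Fin (3 + 1) → ℂ := fun μ => if μ = 1 ∨ μ = 2 then -ζ μ else ζ μ

/-- `rot3_apply_zero`: component formula / elementary identity. [folklore] -/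
@[simp] theorem rot3_apply_zero (ζ : Fin (3 + 1) → ℂ) : rot3 ζ 0 = ζ 0 := by simp [rot3]
/-- `rot3_apply_one`: component formula / elementary identity. [folklore] -/
@[simp] theorem rot3_apply_one (ζ : Fin (3 + 1) → ℂ) : rot3 ζ 1 = -ζ 1 := by simp [rot3]
/-- `rot3_apply_two`: component formula / elementary identity. [folklore] -/
@[simp] theorem rot3_apply_two (ζ : Fin (3 + 1) → ℂ) : rot3 ζ 2 = -ζ 2 := by simp [rot3]
/-- `rot3_apply_three`: component formula / elementary identity. [folklore] -/
@[simp] theorem rot3_apply_three (ζ : Fin (3 + 1) → ℂ) : rot3 ζ 3 = ζ 3 := by simp [rot3]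
/-- `lcU_rot3`: component formula / elementary identity. [folklore] -/
@[simp] theorem lcU_rot3 (ζ : Fin (3 + 1) → ℂ) : lcU (rot3 ζ) = lcU ζ := by simp [lcU]
/-- `lcV_rot3`: component formula / elementary identity. [folklore] -/
@[simp] theorem lcV_rot3 (ζ : Fin (3 + 1) → ℂ) : lcV (rot3 ζ) = lcV ζ := by simp [lcV]
/-- `imPerpSq_rot3`: component formula / elementary identity. [folklore] -/
@[simp] theorem imPerpSq_rot3 (ζ : Fin (3 + 1) → ℂ) : imPerpSq (rot3 ζ) = imPerpSq ζ := by
  simp [imPerpSq]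

/-- The rotation commutes with the boosts. [folklore] -/
theorem boost_rot3 (w : ℂ) (ζ : Fin (3 + 1) → ℂ) : boost w (rot3 ζ) = rot3 (boost w ζ) :=
  ext_lc (by simp) (by simp) (by simp [boost]) (by simp [boost])

/-- The rotation preserves the tube. [folklore] -/
theorem rot3_mem_upperTube_iff (ζ : Fin (3 + 1) → ℂ) : rot3 ζ ∈ upperTube ↔ ζ ∈ upperTube := by
  simp only [mem_upperTube_iff, lcU_rot3, lcV_rot3, imPerpSq_rot3]

/-- The rotation preserves the wedge domain. [folklore] -/
theorem rot3_mem_wedgeDomain_iff (ζ : Fin (3 + 1) → ℂ) : rot3 ζ ∈ wedgeDomain ↔ ζ ∈ wedgeDomain := by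
  simp only [wedgeDomain, mem_setOf_eq, boost_rot3, rot3_mem_upperTube_iff, lcU_rot3, lcV_rot3]

/-- **Rotation covariance passes to the wedge extension**: if `F(R ζ) = M_R F(ζ)` on `T⁺` for the
rotation `R` by `π` about the third axis and `M_R` commutes with `M(−iπ/2)`, then
`F♯(R ζ) = M_R F♯(ζ)` on the wedge domain. [folklore] -/
theorem wedgeExtension_rot3 {MR : E →L[ℂ] E} (hrot : ∀ ζ ∈ upperTube, F (rot3 ζ) = MR (F ζ))
    (hcomm : M (-(π / 2 * I)) * MR = MR * M (-(π / 2 * I))) {ζ : Fin (3 + 1) → ℂ}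
    (hζ : ζ ∈ wedgeDomain) : wedgeExtension M F (rot3 ζ) = MR (wedgeExtension M F ζ) := by
  simp only [wedgeExtension]
  rw [boost_rot3, hrot _ hζ.1]
  change (M (-(π / 2 * I)) * MR) (F (boost (π / 2 * I) ζ)) = _
  rw [hcomm]
  rfl

/-- The parity `P₃ : ζ³ ↦ −ζ³` (it exchanges `u` and `v`). [folklore] -/
def parity3 (ζ : Fin (3 + 1) → ℂ) : Fin (3 + 1) → ℂ := fun μ => if μ = 3 then -ζ μ else ζ μ

/-- `parity3_apply_zero`: component formula / elementary identity. [folklore] -/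
@[simp] theorem parity3_apply_zero (ζ : Fin (3 + 1) → ℂ) : parity3 ζ 0 = ζ 0 := by simp [parity3]
/-- `parity3_apply_one`: component formula / elementary identity. [folklore] -/
@[simp] theorem parity3_apply_one (ζ : Fin (3 + 1) → ℂ) : parity3 ζ 1 = ζ 1 := by simp [parity3]
/-- `parity3_apply_two`: component formula / elementary identity. [folklore] -/
@[simp] theorem parity3_apply_two (ζ : Fin (3 + 1) → ℂ) : parity3 ζ 2 = ζ 2 := by simp [parity3]
/-- `parity3_apply_three`: component formula / elementary identity. [folklore] -/
@[simp] theorem parity3_apply_three (ζ : Fin (3 + 1) → ℂ) : parity3 ζ 3 = -ζ 3 := by simp [parity3]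
/-- `lcU_parity3`: component formula / elementary identity. [folklore] -/
@[simp] theorem lcU_parity3 (ζ : Fin (3 + 1) → ℂ) : lcU (parity3 ζ) = lcV ζ := by
  simp [lcU, lcV, sub_eq_add_neg]
/-- `lcV_parity3`: component formula / elementary identity. [folklore] -/
@[simp] theorem lcV_parity3 (ζ : Fin (3 + 1) → ℂ) : lcV (parity3 ζ) = lcU ζ := by
  simp [lcU, lcV]
/-- `imPerpSq_parity3`: component formula / elementary identity. [folklore] -/
@[simp] theorem imPerpSq_parity3 (ζ : Fin (3 + 1) → ℂ) : imPerpSq (parity3 ζ) = imPerpSq ζ := by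
  simp [imPerpSq]

/-- `P₃` is an involution. [folklore] -/
@[simp] theorem parity3_parity3 (ζ : Fin (3 + 1) → ℂ) : parity3 (parity3 ζ) = ζ := by
  funext μ; simp only [parity3]; split_ifs <;> simp

/-- The parity conjugates `B(w)` to `B(−w)`: `B(w) P₃ = P₃ B(−w)`. [folklore] -/
theorem boost_parity3 (w : ℂ) (ζ : Fin (3 + 1) → ℂ) : boost w (parity3 ζ) = parity3 (boost (-w) ζ) :=
  ext_lc (by simp) (by simp) (by simp [boost]) (by simp [boost])

/-- The parity preserves the tube. [folklore] -/
theorem parity3_mem_upperTube_iff (ζ : Fin (3 + 1) → ℂ) : parity3 ζ ∈ upperTube ↔ ζ ∈ upperTube := by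
  simp only [mem_upperTube_iff, lcU_parity3, lcV_parity3, imPerpSq_parity3]
  constructor <;> rintro ⟨h1, h2, h3⟩ <;> exact ⟨h2, h1, by rwa [mul_comm]⟩

/-- `P₃` is continuous. [folklore] -/
theorem continuous_parity3 : Continuous parity3 := by
  refine continuous_pi fun μ => ?_
  simp only [parity3]
  split_ifs
  · exact (continuous_apply μ).neg
  · exact continuous_apply μ

/-- `P₃` is complex differentiable. [folklore] -/
theorem differentiable_parity3 : Differentiable ℂ parity3 := by
  refine differentiable_pi.2 fun μ => ?_
  simp only [parity3]
  split_ifs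
  · exact (differentiable_apply μ).neg
  · exact differentiable_apply μ

/-- **Transport to the left wedge by parity**: if `F` is covariant under the boosts with the group
`M`, then `F ∘ P₃` is covariant with the group `w ↦ M(−w)`; it is holomorphic on `T⁺` if `F` is.
(The left spacelike wedge `{ξ³ < −|ξ⁰|}` is `P₃` of the right one, so all statements about the
left wedge are those of this file applied to `F ∘ P₃`.) [folklore] -/
theorem parity3_covariant (hcov : ∀ (χ : ℝ), ∀ ζ ∈ upperTube, F (boost χ ζ) = M χ (F ζ)) (χ : ℝ)
    {ζ : Fin (3 + 1) → ℂ} (hζ : ζ ∈ upperTube) :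
    F (parity3 (boost χ ζ)) = M (-(χ : ℂ)) (F (parity3 ζ)) := by
  have h := hcov (-χ) (parity3 ζ) ((parity3_mem_upperTube_iff ζ).2 hζ)
  rw [boost_parity3, Complex.ofReal_neg, neg_neg] at h
  rw [h]

/-- `F ∘ P₃` is holomorphic on the tube if `F` is. [folklore] -/
theorem differentiableOn_comp_parity3 (hF : DifferentiableOn ℂ F upperTube) :
    DifferentiableOn ℂ (fun ζ => F (parity3 ζ)) upperTube := fun ζ hζ =>
  ((hF.differentiableAt (isOpen_upperTube.mem_nhds ((parity3_mem_upperTube_iff ζ).2 hζ))).comp ζ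
    differentiable_parity3.differentiableAt).differentiableWithinAt

end Wedge

end TubeBoost

end Literature.MathematicalPhysics.QuantumLattice
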